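import Literature.AnabelianGeometry.AbsoluteAnabelian.MonoidKummerMapsProofs
import Literature.AnabelianGeometry.AbsoluteAnabelian.AbsTopIII.KummerFaithfulLocalFieldProofs
import HarnessLib

/-!
# [AbsTopIII] Prop 3.3 (ii), model case `T = TLG`: an equivariant automorphism of `k̄^×` over the
# identity of `G_k` is the identity or the inversion

Proof-only companion (theorems only, no new definitions) of `MonoidKummerMaps.lean` (seat
abc-iut-L4-t2; S. Mochizuki, *Topics in Absolute Anabelian Geometry III*, Prop. 3.3 (ii) p. 74,
kurims manuscript, lit key `paper:url-5493eb38cbb7`: "if `T = TLG`, then the resulting map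
`Isom((Π ↷ M),(Π* ↷ M*)) → Isom(Π, Π*)` is surjective, with fibers of cardinality two").

The FIBRE part of that sentence, for the model `TLG`-object `k̄^×` (`nonZeroDivisors k̄`) of the model
data `(k, k̄)` (`MLFClosure`): a multiplicative automorphism `γ` of `k̄^×` commuting with
`G_k = Gal(k̄/k)` is either the identity or `x ↦ x⁻¹`
(`MLFClosure.nonZeroDivisors_mulEquiv_eq_self_or_eq_inv`).  Proof (the Kummer-class argument of the
text, following abc-iut-L6-t13's `MonoidKummerMapsProofs.lean` for `𝒪_k̄^⊳`, whose Steps 1–2 are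
re-run here for `k̄^×`): `γ` acts on `μ_n(k̄)` by an exponent `m_n`; for a uniformiser `ϖ ∈ k` the
Kummer relations `γ(ϖ) = β₁ⁿ ϖ^{m_n}`, `ϖ = β₂ⁿ (γ⁻¹ϖ)^{m_n}` in `k` give, for the orders
`c = ord γ(ϖ)`, `d = ord γ⁻¹(ϖ)`, the congruence `c·d ≡ 1 (mod n)` for every `n`, so `c·d = 1` and
`c = ±1` (for `𝒪_k̄^⊳` integrality forces `c = d = 1`; for `k̄^×` both signs occur).  If `c = ord ϖ`
then `m_n ≡ 1 (mod n)` for all `n`, i.e. `γ` fixes `μ_∞`, and `γ = id` by the rigidity lemma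
`MLFClosure.submonoid_equivariant_eq_self` (`KummerFaithfulLocalFieldProofs.lean`); otherwise the same
applies to `γ ∘ (·)⁻¹`.

HONEST FRAMING: OUR kernel check of (part of) a statement of a refereed paper; nothing here bears on
[IUTchIII] Cor. 3.12.
-/

noncomputable section

open scoped Classical

namespace Literature.AnabelianGeometry.AbsoluteAnabelian

open _root_.ValuativeRel IntermediateField
open Literature.NumberTheory.GaloisRepresentations

universe u

namespace MLFClosure

variable (C : MLFClosure.{u})

/-! ## Preliminaries on the model `(G_k ↷ k̄^×)` -/

/-- An `n`-th root of an element of `k̄^×` lies in `k̄^×`. [cite: MochizukiAbsTopIII2015, Proposition 3.3 (ii) p.74] -/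
theorem mem_nonZeroDivisors_of_pow_eq {y : C.K} {n : ℕ} (hn : 0 < n) {x : C.K}
    (hx : x ∈ nonZeroDivisors C.K) (hy : y ^ n = x) : y ∈ nonZeroDivisors C.K := by
  refine mem_nonZeroDivisors_of_ne_zero ?_
  rintro rfl
  rw [zero_pow hn.ne'] at hy
  exact (nonZeroDivisors.ne_zero hx) hy.symm

variable {C}

/-- The shape of the equivariance hypothesis: `γ` commutes with `G_k`; on fixed points.
[cite: MochizukiAbsTopIII2015, Proposition 3.3 (ii) p.74] -/
theorem units_equivariant_apply_eq_of_fixed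
    {γ : ↥(nonZeroDivisors C.K) ≃* ↥(nonZeroDivisors C.K)}
    (hγ : ∀ (σ : C.K ≃ₐ[C.k] C.K) (x : ↥(nonZeroDivisors C.K)),
      (γ ⟨σ • (x : C.K), smul_mem_nonZeroDivisors σ x.2⟩ : C.K) = σ • (γ x : C.K))
    {σ : C.K ≃ₐ[C.k] C.K} {x : ↥(nonZeroDivisors C.K)} (hx : σ (x : C.K) = x) :
    σ (γ x : C.K) = γ x := by
  have h := hγ σ x
  have hsub : (⟨σ • (x : C.K), smul_mem_nonZeroDivisors σ x.2⟩ : ↥(nonZeroDivisors C.K)) = x :=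
    Subtype.ext (show σ • (x : C.K) = x by rw [AlgEquiv.smul_def, hx])
  rw [hsub, AlgEquiv.smul_def] at h
  exact h.symm

/-- The inverse of an equivariant automorphism of `k̄^×` is equivariant. [cite: MochizukiAbsTopIII2015, Proposition 3.3 (ii) p.74] -/
theorem units_equivariant_symm
    {γ : ↥(nonZeroDivisors C.K) ≃* ↥(nonZeroDivisors C.K)}
    (hγ : ∀ (σ : C.K ≃ₐ[C.k] C.K) (x : ↥(nonZeroDivisors C.K)),
      (γ ⟨σ • (x : C.K), smul_mem_nonZeroDivisors σ x.2⟩ : C.K) = σ • (γ x : C.K))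
    (σ : C.K ≃ₐ[C.k] C.K) (x : ↥(nonZeroDivisors C.K)) :
    (γ.symm ⟨σ • (x : C.K), smul_mem_nonZeroDivisors σ x.2⟩ : C.K) = σ • (γ.symm x : C.K) := by
  have h := hγ σ (γ.symm x)
  rw [MulEquiv.apply_symm_apply] at h
  have h' : γ ⟨σ • (γ.symm x : C.K), smul_mem_nonZeroDivisors σ (γ.symm x).2⟩ =
      ⟨σ • (x : C.K), smul_mem_nonZeroDivisors σ x.2⟩ := Subtype.ext h
  have := congrArg γ.symm h'
  rw [MulEquiv.symm_apply_apply] at this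
  rw [← this]

/-- The composite of an equivariant automorphism of `k̄^×` with the inversion is equivariant.
[cite: MochizukiAbsTopIII2015, Proposition 3.3 (ii) p.74] -/
theorem units_equivariant_trans
    {γ δ : ↥(nonZeroDivisors C.K) ≃* ↥(nonZeroDivisors C.K)}
    (hγ : ∀ (σ : C.K ≃ₐ[C.k] C.K) (x : ↥(nonZeroDivisors C.K)),
      (γ ⟨σ • (x : C.K), smul_mem_nonZeroDivisors σ x.2⟩ : C.K) = σ • (γ x : C.K))
    (hδ : ∀ (σ : C.K ≃ₐ[C.k] C.K) (x : ↥(nonZeroDivisors C.K)),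
      (δ ⟨σ • (x : C.K), smul_mem_nonZeroDivisors σ x.2⟩ : C.K) = σ • (δ x : C.K))
    (σ : C.K ≃ₐ[C.k] C.K) (x : ↥(nonZeroDivisors C.K)) :
    ((γ.trans δ) ⟨σ • (x : C.K), smul_mem_nonZeroDivisors σ x.2⟩ : C.K) = σ • ((γ.trans δ) x : C.K) := by
  rw [MulEquiv.trans_apply, MulEquiv.trans_apply]
  have h1 : γ ⟨σ • (x : C.K), smul_mem_nonZeroDivisors σ x.2⟩ =
      ⟨σ • (γ x : C.K), smul_mem_nonZeroDivisors σ (γ x).2⟩ := Subtype.ext (hγ σ x)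
  rw [h1, hδ σ (γ x)]

/-! ## Step 1: roots of unity -/

/-- STEP 1. For `n ≥ 1` there is `m : ℕ` with `γ u = u ^ m` for every `u ∈ k̄^×` with `uⁿ = 1`.
[cite: MochizukiAbsTopIII2015, Proposition 3.3 (ii) p.74] -/
theorem units_exists_pow_eq_on_rootsOfUnity (γ : ↥(nonZeroDivisors C.K) ≃* ↥(nonZeroDivisors C.K))
    {n : ℕ} (hn : 0 < n) :
    ∃ m : ℕ, ∀ u : ↥(nonZeroDivisors C.K), (u : C.K) ^ n = 1 → γ u = u ^ m := by
  haveI : IsAlgClosed C.K := IsAlgClosure.isAlgClosed C.k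
  haveI : CharZero C.K := charZero_of_injective_algebraMap (algebraMap C.k C.K).injective
  haveI : NeZero n := ⟨hn.ne'⟩
  obtain ⟨ζ, hζ⟩ := HasEnoughRootsOfUnity.exists_primitiveRoot C.K n
  set u₀ : ↥(nonZeroDivisors C.K) :=
    ⟨ζ, C.mem_nonZeroDivisors_of_pow_eq hn (Submonoid.one_mem _) hζ.pow_eq_one⟩ with hu₀
  have hγu₀ : ((γ u₀ : ↥(nonZeroDivisors C.K)) : C.K) ^ n = 1 := by
    have h1 : u₀ ^ n = 1 := Subtype.ext (by
      rw [SubmonoidClass.coe_pow, hu₀]; exact hζ.pow_eq_one)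
    have h2 : (γ u₀) ^ n = 1 := by rw [← map_pow, h1, map_one]
    have h3 := congrArg (fun z : ↥(nonZeroDivisors C.K) => (z : C.K)) h2
    simpa using h3
  obtain ⟨m, -, hm⟩ := hζ.eq_pow_of_pow_eq_one hγu₀
  refine ⟨m, fun u hu => ?_⟩
  obtain ⟨i, -, hi⟩ := hζ.eq_pow_of_pow_eq_one hu
  have hu' : u = u₀ ^ i := Subtype.ext (by rw [SubmonoidClass.coe_pow, hu₀]; exact hi.symm)
  have hγu₀' : γ u₀ = u₀ ^ m := Subtype.ext (by rw [SubmonoidClass.coe_pow, hu₀]; exact hm.symm)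
  rw [hu', map_pow, hγu₀', ← pow_mul, ← pow_mul, mul_comm]

/-! ## Step 2: the Kummer relation -/

/-- STEP 2 (Kummer). If `γ` is equivariant and acts on `μ_n` by the `m`-th power, then for every
`x ∈ k̄^×` there is `β ∈ k̄^×`, fixed by every `τ ∈ G_k` fixing `x`, with `γ(x) = βⁿ · x^m`.
[cite: MochizukiAbsTopIII2015, Proposition 3.3 (ii) p.74] -/
theorem units_exists_kummer_relation
    {γ : ↥(nonZeroDivisors C.K) ≃* ↥(nonZeroDivisors C.K)}
    (hγ : ∀ (σ : C.K ≃ₐ[C.k] C.K) (x : ↥(nonZeroDivisors C.K)),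
      (γ ⟨σ • (x : C.K), smul_mem_nonZeroDivisors σ x.2⟩ : C.K) = σ • (γ x : C.K))
    {n m : ℕ} (hn : 0 < n)
    (hm : ∀ u : ↥(nonZeroDivisors C.K), (u : C.K) ^ n = 1 → γ u = u ^ m)
    (x : ↥(nonZeroDivisors C.K)) :
    ∃ β : C.K, β ≠ 0 ∧ (∀ τ : C.K ≃ₐ[C.k] C.K, τ (x : C.K) = x → τ β = β) ∧
      (γ x : C.K) = β ^ n * (x : C.K) ^ m := by
  haveI : IsAlgClosed C.K := IsAlgClosure.isAlgClosed C.k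
  have hx0 : (x : C.K) ≠ 0 := nonZeroDivisors.coe_ne_zero x
  obtain ⟨y, hy⟩ := IsAlgClosed.exists_pow_nat_eq (x : C.K) hn
  have hyM : y ∈ nonZeroDivisors C.K := C.mem_nonZeroDivisors_of_pow_eq hn x.2 hy
  have hy0 : y ≠ 0 := nonZeroDivisors.ne_zero hyM
  set yM : ↥(nonZeroDivisors C.K) := ⟨y, hyM⟩ with hyMdef
  have hxy : x = yM ^ n := Subtype.ext (by rw [SubmonoidClass.coe_pow, hyMdef]; exact hy.symm)
  set β : C.K := (γ yM : C.K) / y ^ m with hβ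
  have hγy0 : (γ yM : C.K) ≠ 0 := nonZeroDivisors.coe_ne_zero (γ yM)
  have hβ0 : β ≠ 0 := div_ne_zero hγy0 (pow_ne_zero _ hy0)
  refine ⟨β, hβ0, fun τ hτ => ?_, ?_⟩
  · set ζ : C.K := τ y / y with hζ
    have hζn : ζ ^ n = 1 := by
      rw [hζ, div_pow, ← map_pow, hy, hτ, div_self hx0]
    have hζM : ζ ∈ nonZeroDivisors C.K :=
      C.mem_nonZeroDivisors_of_pow_eq hn (Submonoid.one_mem _) hζn
    set ζM : ↥(nonZeroDivisors C.K) := ⟨ζ, hζM⟩ with hζMdef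
    have hτy : τ y = ζ * y := by rw [hζ, div_mul_cancel₀ _ hy0]
    have h1 := hγ τ yM
    have h2 : (⟨τ • (yM : C.K), smul_mem_nonZeroDivisors τ yM.2⟩ : ↥(nonZeroDivisors C.K)) =
        ζM * yM := Subtype.ext (by
      show τ • y = ζ * y
      rw [AlgEquiv.smul_def, hτy])
    rw [h2, map_mul, hm ζM hζn, AlgEquiv.smul_def] at h1
    have h3 : τ (γ yM : C.K) = ζ ^ m * (γ yM : C.K) := by
      rw [← h1, Submonoid.coe_mul, SubmonoidClass.coe_pow]
    have hζ0 : ζ ≠ 0 := nonZeroDivisors.ne_zero hζM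
    rw [hβ, map_div₀, map_pow, h3, hτy, mul_pow]
    exact mul_div_mul_left _ _ (pow_ne_zero _ hζ0)
  · have hγy : (γ yM : C.K) = β * y ^ m := by rw [hβ, div_mul_cancel₀ _ (pow_ne_zero _ hy0)]
    rw [hxy, map_pow, SubmonoidClass.coe_pow, hγy, mul_pow, ← pow_mul, SubmonoidClass.coe_pow,
      hyMdef, ← pow_mul, mul_comm m n]

/-! ## Step 3: the valuation of `k` and the dichotomy -/

/-- The normalised additive valuation of a non-archimedean local field as plain data (adapted from
abc-iut-L6-t13's private `exists_ord`, `MonoidKummerMapsProofs.lean`): `ord : k → ℤ` additive on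
non-zero elements, `= -1` at a uniformiser `ϖ`. Ref: Serre, *Local Fields*, Ch. II §1. [folklore] -/
private theorem exists_ord' (k : Type u) [Field k] [ValuativeRel k] [TopologicalSpace k]
    [IsNonarchimedeanLocalField k] :
    ∃ (ord : k → ℤ) (ϖ : k), ϖ ≠ 0 ∧ ord ϖ = -1 ∧
      (∀ a b : k, a ≠ 0 → b ≠ 0 → ord (a * b) = ord a + ord b) ∧
      (∀ (a : k) (n : ℕ), a ≠ 0 → ord (a ^ n) = n * ord a) := by
  set e := _root_.IsNonarchimedeanLocalField.valueGroupWithZeroIsoInt k with he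
  refine ⟨fun a => WithZero.log (e (valuation k a)), ?_⟩
  obtain ⟨ϖ, hϖ⟩ := exists_units_isUniformizer (F := k)
  have hne : ∀ a : k, a ≠ 0 → e (valuation k a) ≠ 0 := fun a ha h =>
    ((Valuation.ne_zero_iff _).mpr ha) (e.injective (h.trans (map_zero e).symm))
  refine ⟨(ϖ : k), ϖ.ne_zero, ?_, ?_, ?_⟩
  · show WithZero.log (e (valuation k (ϖ : k))) = -1
    rw [hϖ.val, IsNonarchimedeanLocalField.valueGroupWithZeroIsoInt_generator, WithZero.log_exp]
  · intro a b ha hb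
    show WithZero.log (e (valuation k (a * b))) = WithZero.log (e (valuation k a)) +
      WithZero.log (e (valuation k b))
    rw [map_mul, map_mul, WithZero.log_mul (hne a ha) (hne b hb)]
  · intro a n ha
    show WithZero.log (e (valuation k (a ^ n))) = n * WithZero.log (e (valuation k a))
    rw [map_pow, map_pow, WithZero.log_pow, nsmul_eq_mul]

/-- An element of `k̄` fixed by every element of `G_k` lies in `k`. [folklore] -/
private theorem exists_algebraMap_eq_of_fixed' {y : C.K} (hfix : ∀ σ : C.K ≃ₐ[C.k] C.K, σ y = y) :
    ∃ a : C.k, algebraMap C.k C.K a = y := by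
  have h : y ∈ IntermediateField.fixedField (⊥ : IntermediateField C.k C.K).fixingSubgroup := by
    rw [IntermediateField.fixingSubgroup_bot, IntermediateField.mem_fixedField_iff]
    exact fun σ _ => hfix σ
  rw [InfiniteGalois.fixedField_fixingSubgroup, IntermediateField.mem_bot] at h
  exact h

/-- STEP 3a. If `γ` is equivariant and, for every `n ≥ 1`, fixes the `n`-th roots of unity, then
`γ = id` (the rigidity lemma `MLFClosure.submonoid_equivariant_eq_self` for `M = k̄^×`).
[cite: MochizukiAbsTopIII2015, Proposition 3.3 (ii) p.74] -/
theorem nonZeroDivisors_mulEquiv_eq_self_of_fix_rootsOfUnity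
    (γ : ↥(nonZeroDivisors C.K) ≃* ↥(nonZeroDivisors C.K))
    (hγ : ∀ (σ : C.K ≃ₐ[C.k] C.K) (x : ↥(nonZeroDivisors C.K)),
      (γ ⟨σ • (x : C.K), smul_mem_nonZeroDivisors σ x.2⟩ : C.K) = σ • (γ x : C.K))
    (hfix : ∀ (x : ↥(nonZeroDivisors C.K)) (n : ℕ), 0 < n → (x : C.K) ^ n = 1 → γ x = x)
    (x : ↥(nonZeroDivisors C.K)) : γ x = x := by
  haveI : IsAlgClosed C.K := IsAlgClosure.isAlgClosed C.k
  refine MLFClosure.submonoid_equivariant_eq_self C (nonZeroDivisors C.K)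
    (fun σ z hz => by simpa [AlgEquiv.smul_def] using smul_mem_nonZeroDivisors σ hz)
    (fun z hz n hn => ?_) (fun ζ n hn hζ => ?_) (fun h => (nonZeroDivisors.ne_zero h) rfl)
    γ.toMonoidHom (fun σ z => ?_) (fun z n hn hz => hfix z n hn hz) x
  · obtain ⟨y, hy⟩ := IsAlgClosed.exists_pow_nat_eq z hn
    exact ⟨y, C.mem_nonZeroDivisors_of_pow_eq hn hz hy, hy⟩
  · exact C.mem_nonZeroDivisors_of_pow_eq hn (Submonoid.one_mem _) hζ
  · exact hγ σ z

/-- **An equivariant automorphism of `k̄^×` over the identity of `G_k` is the identity or the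
inversion** — the "fibres of cardinality two" part of [AbsTopIII] Prop. 3.3 (ii) for the model
`TLG`-pair. [cite: MochizukiAbsTopIII2015, Proposition 3.3 (ii) p.74] -/
theorem nonZeroDivisors_mulEquiv_eq_self_or_eq_inv
    (γ : ↥(nonZeroDivisors C.K) ≃* ↥(nonZeroDivisors C.K))
    (hγ : ∀ (σ : C.K ≃ₐ[C.k] C.K) (x : ↥(nonZeroDivisors C.K)),
      (γ ⟨σ • (x : C.K), smul_mem_nonZeroDivisors σ x.2⟩ : C.K) = σ • (γ x : C.K)) :
    (∀ x, γ x = x) ∨ (∀ x : ↥(nonZeroDivisors C.K), (γ x : C.K) = (x : C.K)⁻¹) := by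
  haveI : IsAlgClosed C.K := IsAlgClosure.isAlgClosed C.k
  obtain ⟨ord, ϖ, hϖ0, hordϖ, hmul, hpow⟩ := exists_ord' C.k
  have hinj := (algebraMap C.k C.K).injective
  have hord1 : ord 1 = 0 := by
    have := hmul 1 1 one_ne_zero one_ne_zero
    rw [mul_one] at this
    linarith
  have hordinv : ∀ a : C.k, a ≠ 0 → ord a⁻¹ = - ord a := by
    intro a ha
    have := hmul a a⁻¹ ha (inv_ne_zero ha)
    rw [mul_inv_cancel₀ ha, hord1] at this
    linarith
  set ϖK : C.K := algebraMap C.k C.K ϖ with hϖK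
  have hϖK0 : ϖK ≠ 0 := (map_ne_zero_iff _ hinj).mpr hϖ0
  set P : ↥(nonZeroDivisors C.K) := ⟨ϖK, mem_nonZeroDivisors_of_ne_zero hϖK0⟩ with hP
  have hPfix : ∀ σ : C.K ≃ₐ[C.k] C.K, σ ϖK = ϖK := fun σ => σ.commutes ϖ
  -- the inversion of `k̄^×` as a multiplicative automorphism
  let ι : ↥(nonZeroDivisors C.K) ≃* ↥(nonZeroDivisors C.K) :=
    { toFun := fun z => ⟨(z : C.K)⁻¹, mem_nonZeroDivisors_of_ne_zero
        (inv_ne_zero (nonZeroDivisors.coe_ne_zero z))⟩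
      invFun := fun z => ⟨(z : C.K)⁻¹, mem_nonZeroDivisors_of_ne_zero
        (inv_ne_zero (nonZeroDivisors.coe_ne_zero z))⟩
      left_inv := fun z => Subtype.ext (inv_inv (z : C.K))
      right_inv := fun z => Subtype.ext (inv_inv (z : C.K))
      map_mul' := fun a b => Subtype.ext (by
        show ((a * b : ↥(nonZeroDivisors C.K)) : C.K)⁻¹ = (a : C.K)⁻¹ * (b : C.K)⁻¹
        rw [Submonoid.coe_mul, mul_inv]) }
  have hι : ∀ z : ↥(nonZeroDivisors C.K), (ι z : C.K) = (z : C.K)⁻¹ := fun z => rfl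
  have hιeq : ∀ (σ : C.K ≃ₐ[C.k] C.K) (z : ↥(nonZeroDivisors C.K)),
      (ι ⟨σ • (z : C.K), smul_mem_nonZeroDivisors σ z.2⟩ : C.K) = σ • (ι z : C.K) := by
    intro σ z
    show (σ • (z : C.K))⁻¹ = σ • ((z : C.K)⁻¹)
    rw [AlgEquiv.smul_def, AlgEquiv.smul_def, map_inv₀]
  -- LEMMA: an equivariant `δ` whose value at `ϖ` has order `ord ϖ = -1` is the identity
  have L : ∀ (δ : ↥(nonZeroDivisors C.K) ≃* ↥(nonZeroDivisors C.K)),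
      (∀ (σ : C.K ≃ₐ[C.k] C.K) (x : ↥(nonZeroDivisors C.K)),
        (δ ⟨σ • (x : C.K), smul_mem_nonZeroDivisors σ x.2⟩ : C.K) = σ • (δ x : C.K)) →
      (∀ a : C.k, algebraMap C.k C.K a = (δ P : C.K) → ord a = -1) →
      ∀ x, δ x = x := by
    intro δ hδ hc
    apply nonZeroDivisors_mulEquiv_eq_self_of_fix_rootsOfUnity δ hδ
    intro u N hN huN
    obtain ⟨m, hm⟩ := units_exists_pow_eq_on_rootsOfUnity δ hN
    -- Kummer for `ϖ`: `δ(ϖ) = β^N ϖ^m` with `β ∈ k`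
    obtain ⟨β, hβ0, hβfix, hβrel⟩ := units_exists_kummer_relation hδ hN hm P
    obtain ⟨b, hb⟩ := exists_algebraMap_eq_of_fixed' (fun σ => hβfix σ (hPfix σ))
    have hb0 : b ≠ 0 := fun h0 => hβ0 (by rw [← hb, h0, map_zero])
    have hafix : ∀ σ : C.K ≃ₐ[C.k] C.K, σ (δ P : C.K) = δ P :=
      fun σ => units_equivariant_apply_eq_of_fixed hδ (hPfix σ)
    obtain ⟨a, ha⟩ := exists_algebraMap_eq_of_fixed' hafix
    have ha0 : a ≠ 0 := fun h0 => (nonZeroDivisors.coe_ne_zero (δ P)) (by rw [← ha, h0, map_zero])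
    have hrel : a = b ^ N * ϖ ^ m := hinj (by
      rw [ha, map_mul, map_pow, map_pow, hb]; exact hβrel)
    have horda : ord a = N * ord b + m * ord ϖ := by
      rw [hrel, hmul _ _ (pow_ne_zero _ hb0) (pow_ne_zero _ hϖ0), hpow _ _ hb0, hpow _ _ hϖ0]
    rw [hc a ha, hordϖ] at horda
    -- so `m = N * ord b + 1`
    have hmZ : (m : ℤ) = N * ord b + 1 := by linarith
    have hu0 : (u : C.K) ≠ 0 := nonZeroDivisors.coe_ne_zero u
    rw [hm u huN]
    apply Subtype.ext
    rw [SubmonoidClass.coe_pow, ← zpow_natCast (u : C.K) m, hmZ, zpow_add₀ hu0, zpow_one,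
      zpow_mul, zpow_natCast, huN, one_zpow, one_mul]
  -- the orders `c = ord δ(ϖ)`, `d = ord δ⁻¹(ϖ)` satisfy `c·d = 1`
  have hafix : ∀ σ : C.K ≃ₐ[C.k] C.K, σ (γ P : C.K) = γ P :=
    fun σ => units_equivariant_apply_eq_of_fixed hγ (hPfix σ)
  obtain ⟨a₀, ha₀⟩ := exists_algebraMap_eq_of_fixed' hafix
  have ha₀0 : a₀ ≠ 0 := fun h0 => (nonZeroDivisors.coe_ne_zero (γ P)) (by rw [← ha₀, h0, map_zero])
  set Q : ↥(nonZeroDivisors C.K) := γ.symm P with hQ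
  have hQfix : ∀ σ : C.K ≃ₐ[C.k] C.K, σ (Q : C.K) = Q := by
    intro σ
    have h := units_equivariant_symm hγ σ P
    have hsub : (⟨σ • (P : C.K), smul_mem_nonZeroDivisors σ P.2⟩ : ↥(nonZeroDivisors C.K)) = P :=
      Subtype.ext (show σ • ϖK = ϖK by rw [AlgEquiv.smul_def, hPfix])
    rw [hsub, AlgEquiv.smul_def] at h
    exact h.symm
  obtain ⟨q₀, hq₀⟩ := exists_algebraMap_eq_of_fixed' hQfix
  have hq₀0 : q₀ ≠ 0 := fun h0 => (nonZeroDivisors.coe_ne_zero Q) (by rw [← hq₀, h0, map_zero])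
  have key : ∀ N : ℕ, 0 < N → (N : ℤ) ∣ ord a₀ * ord q₀ - 1 := by
    intro N hN
    obtain ⟨m, hm⟩ := units_exists_pow_eq_on_rootsOfUnity γ hN
    obtain ⟨β₁, hβ₁0, hβ₁fix, hβ₁⟩ := units_exists_kummer_relation hγ hN hm P
    obtain ⟨b₁, hb₁⟩ := exists_algebraMap_eq_of_fixed' (fun σ => hβ₁fix σ (hPfix σ))
    have hb₁0 : b₁ ≠ 0 := fun h0 => hβ₁0 (by rw [← hb₁, h0, map_zero])
    have hrel₁ : a₀ = b₁ ^ N * ϖ ^ m := hinj (by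
      rw [ha₀, map_mul, map_pow, map_pow, hb₁]; exact hβ₁)
    have hord₁ : ord a₀ = N * ord b₁ + m * ord ϖ := by
      rw [hrel₁, hmul _ _ (pow_ne_zero _ hb₁0) (pow_ne_zero _ hϖ0), hpow _ _ hb₁0, hpow _ _ hϖ0]
    obtain ⟨β₂, hβ₂0, hβ₂fix, hβ₂⟩ := units_exists_kummer_relation hγ hN hm Q
    obtain ⟨b₂, hb₂⟩ := exists_algebraMap_eq_of_fixed' (fun σ => hβ₂fix σ (hQfix σ))
    have hb₂0 : b₂ ≠ 0 := fun h0 => hβ₂0 (by rw [← hb₂, h0, map_zero])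
    have hγQ : (γ Q : C.K) = ϖK := by rw [hQ, MulEquiv.apply_symm_apply]
    have hrel₂ : ϖ = b₂ ^ N * q₀ ^ m := hinj (by
      rw [map_mul, map_pow, map_pow, hb₂, hq₀, ← hϖK, ← hγQ]; exact hβ₂)
    have hord₂ : ord ϖ = N * ord b₂ + m * ord q₀ := by
      rw [hrel₂, hmul _ _ (pow_ne_zero _ hb₂0) (pow_ne_zero _ hq₀0), hpow _ _ hb₂0, hpow _ _ hq₀0]
    rw [hordϖ] at hord₁ hord₂
    exact ⟨ord b₂ + ord q₀ * ord b₁, by linear_combination (ord q₀) * hord₁ + hord₂⟩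
  have hcd : ord a₀ * ord q₀ - 1 = 0 := by
    have hdvd := key ((ord a₀ * ord q₀ - 1).natAbs + 1) (Nat.succ_pos _)
    exact Int.eq_zero_of_dvd_of_natAbs_lt_natAbs hdvd
      (by rw [Int.natAbs_natCast]; exact Nat.lt_succ_self _)
  have hprod : ord a₀ * ord q₀ = 1 := by linarith
  rcases Int.eq_one_or_neg_one_of_mul_eq_one hprod with hc | hc
  · -- `ord γ(ϖ) = 1 = -ord ϖ`: then `γ ∘ ι` preserves the order of `ϖ`, so `γ ∘ ι = id`
    right
    have hL := L (γ.trans ι) (units_equivariant_trans hγ hιeq) (by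
      intro a ha
      rw [MulEquiv.trans_apply, hι, ← ha₀, ← map_inv₀] at ha
      rw [hinj ha, hordinv a₀ ha₀0, hc])
    intro x
    have h := congrArg (fun z : ↥(nonZeroDivisors C.K) => (z : C.K)) (hL x)
    simp only [MulEquiv.trans_apply, hι] at h
    rw [← h, inv_inv]
  · -- `ord γ(ϖ) = -1 = ord ϖ`: `γ = id`
    left
    exact L γ hγ (fun a ha => by rw [hinj (ha.trans ha₀.symm)]; exact hc)

end MLFClosure

end Literature.AnabelianGeometry.AbsoluteAnabelian

end
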